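import Summits.ResolutionOfSingularities.ResolutionOfSingularities.Theses.AbhyankarShadows
import Summits.ResolutionOfSingularities.ResolutionOfSingularities.Theses.Descent
import Summits.ResolutionOfSingularities.ResolutionOfSingularities.Theorems.RisoStrataDescentAlgclosedToPerfectGaloisInvariant
import Summits.ResolutionOfSingularities.ResolutionOfSingularities.Theorems.AbhyankarShadowsDescentAlgclosedToPerfectInvariantIdealOfStableRegularBlowup

/-!
# Line `npc-fixed-vertex` (payload slug `Sketch`) for crux `DescentAlgclosedToPerfect`
# (stmt-ResolutionOfSingularities-0550) — lead's skeleton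

Line lead re-seat a2 (prover-line-stmt-ResolutionOfSingularities-0550-a2-0, 2026-08-17). The crux
(shared `rfl`-equally by the routes AbhyankarShadows / RisoStrata / Descent / UniformComplexity /
EquisingularLift / TropicalLinks / TeissierJung / AnalyticWildDescent):
`∀ p prime, AlgClosedRes p → PerfectRes p`.

Source of the line: crux idea `npc-fixed-vertex` (crux-ideate r1 k2,
`Cruxes/DescentAlgclosedToPerfect/Ideas/npc-fixed-vertex.md`; its `Sketch.lean`, evidence
20260817T153051Z, is the payload line `Sketch`). The card's lever: a Galois-FIXED VERTEX of the
graded poset of regular projective models of `X_{k̄}` is a regular blow-up `Y = Bl_I X_L` which is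
ALSO a blow-up along every Galois conjugate `σ(I)` ("stable"); then the norm ideal `∏_σ σ(I)` is a
Galois-invariant resolving ideal and the landed descent side (p150140,
`Theorems.descentAlgclosedToPerfect_of_galoisInvariantResolvingIdeal`) closes the crux.

Stubs (registered with `ledger skeleton check`):
* `stub_invariantIdeal_of_stableRegularBlowup` — CLOSED (wave 1, p172404,
  `Theorems.stub_invariantIdeal_of_stableRegularBlowup`). The card's FIRST LEMMA (from the tree's
  `BlowupsProduct`: `IsEffectiveCartier.mul/of_mul_left`, `comap_mul`, `gal_mul`): a blow-up
  `ρ` of `X_L` along `I ≠ ⊥` that is also a blow-up along every conjugate `σ⁻¹(I)` is a blow-up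
  along the Galois-INVARIANT norm ideal `J = ∏_σ σ⁻¹(I) ≠ ⊥`.
* `stub_fixedVertexPrinciple` — the card's `FixedVertexPrinciple` (OPEN; the residue of the crux in
  "stable blow-up" form): from resolution over algebraically closed fields of characteristic `p`,
  every integral separated `X` of finite type over a perfect `k` of characteristic `p` has, at some
  finite Galois level `L/k`, a regular blow-up `Y → X_L` along some `I ≠ ⊥` which is a blow-up along
  every conjugate of `I`. (Card: to be cut into (W) relative weak factorisation over `k̄` from the
  oracle, (NPC) non-positive curvature of the orthoscheme complex of regular models, (F) fixed cell ⇒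
  fixed vertex; none of the three is in the tree's language yet.)

Composition `DescentAlgclosedToPerfect_of` (alias `DescentAlgclosedToPerfect_proof`) concludes
`Summit.ResolutionOfSingularities.ResolutionOfSingularities.Theses.Descent.DescentAlgclosedToPerfect`
BY NAME (the item's canonical copy; kernel-checked modulo the two stubs), and
`DescentAlgclosedToPerfect_of_abhyankarShadows` the `rfl`-equal copy of the lead's route
`Theses.AbhyankarShadows.DescentAlgclosedToPerfect`.
-/

noncomputable section

set_option linter.dupNamespace false

open CategoryTheory CategoryTheory.Limits AlgebraicGeometry
open Literature.AlgebraicGeometry.Resolution Literature.AlgebraicGeometry.Motives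
open Literature.AlgebraicGeometry.Motives.AbelianVariety (bcSpec)

namespace Summit.ResolutionOfSingularities.ResolutionOfSingularities.Cruxes.DescentAlgclosedToPerfect.Lines.NpcFixedVertex

/-- STUB `stub_invariantIdeal_of_stableRegularBlowup` (the card's first lemma
`invariantIdeal_of_stableRegularBlowup`; provable now). Let `L/k` be finite Galois, `X` a
`k`-scheme with `X_L = X ×_k Spec L` reduced, `I ≠ ⊥` an ideal sheaf on `X_L`, and `ρ : Y ⟶ X_L` a
blow-up along `I` which is ALSO a blow-up along every Galois conjugate `(gal σ)⁻¹ I · 𝒪`. Then `ρ`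
is a blow-up along a non-zero Galois-INVARIANT ideal sheaf `J` (the norm ideal `∏_σ (gal σ)⁻¹ I`).
[cite: StacksProject, Tag 080A; Kollar2007, 3.34.2] -/
theorem stub_invariantIdeal_of_stableRegularBlowup {k : Type} [Field k] (L : Type) [Field L]
    [Algebra k L] [FiniteDimensional k L] [IsGalois k L] (X : SchemeOver k)
    [IsReduced (GaloisDescent.bc L X)]
    {I : (GaloisDescent.bc L X).IdealSheafData} (hI0 : I ≠ ⊥) {Y : Scheme.{0}}
    {ρ : Y ⟶ GaloisDescent.bc L X} (hρ : IsBlowup ρ I)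
    (hst : ∀ σ : L ≃ₐ[k] L, IsBlowup ρ (I.comap (GaloisDescent.gal L X σ))) :
    ∃ J : (GaloisDescent.bc L X).IdealSheafData, J ≠ ⊥ ∧
      (∀ σ : L ≃ₐ[k] L, J.comap (GaloisDescent.gal L X σ) = J) ∧ IsBlowup ρ J :=
  -- CLOSED (wave 1, p172404): `Theorems/AbhyankarShadowsDescentAlgclosedToPerfectInvariantIdealOfStableRegularBlowup.lean`
  Theorems.stub_invariantIdeal_of_stableRegularBlowup L X hI0 hρ hst

/-- STUB `stub_fixedVertexPrinciple` (the card's `FixedVertexPrinciple`; OPEN — the residue of the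
crux in stable-blow-up form). Resolution over all algebraically closed fields of characteristic `p`
yields, for every integral separated scheme `X` of finite type over a perfect field `k` of
characteristic `p`, a finite Galois extension `L/k`, a non-zero ideal sheaf `I` on
`X_L = X ×_k Spec L` and a REGULAR blow-up `ρ : Y ⟶ X_L` along `I` which is also a blow-up along
every Galois conjugate `(gal σ)⁻¹ I · 𝒪` (a Galois-fixed vertex of the poset of regular projective
models). [cite: LonjouUrech2021, Thm. 4.19 (the surface precedent); Kollar2007, Thm. 3.36] -/
theorem stub_fixedVertexPrinciple : ∀ p : ℕ, p.Prime →
    (∀ (k : Type) [Field k] [CharP k p] [IsAlgClosed k] (X : Scheme.{0}) (f : X ⟶ Spec (.of k)),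
      IsSeparated f → LocallyOfFiniteType f → QuasiCompact f → IsReduced X →
      Scheme.HasResolution X) →
    ∀ (k : Type) [Field k] [CharP k p] [PerfectField k] (X : Scheme.{0}) (f : X ⟶ Spec (.of k)),
      IsSeparated f → LocallyOfFiniteType f → QuasiCompact f → IsIntegral X →
      ∃ (L : Type) (_ : Field L) (_ : Algebra k L) (_ : FiniteDimensional k L) (_ : IsGalois k L)
        (I : (GaloisDescent.bc L (Over.mk f)).IdealSheafData) (Y : Scheme.{0})
        (ρ : Y ⟶ GaloisDescent.bc L (Over.mk f)),
        I ≠ ⊥ ∧ IsBlowup ρ I ∧ Scheme.IsRegular Y ∧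
          ∀ σ : L ≃ₐ[k] L, IsBlowup ρ (I.comap (GaloisDescent.gal L (Over.mk f) σ)) := by
  sorry

/-- COMPOSITION: the two stubs give the crux BY NAME — a stable regular blow-up at a finite
Galois level has a Galois-invariant resolving (norm) ideal, which descends
(`Theorems.descentAlgclosedToPerfect_of_galoisInvariantResolvingIdeal`, p150140).
[cite: Kollar2007, Thm. 3.36] -/
theorem DescentAlgclosedToPerfect_of :
    Summit.ResolutionOfSingularities.ResolutionOfSingularities.Theses.Descent.DescentAlgclosedToPerfect := by
  refine Theorems.descentAlgclosedToPerfect_of_galoisInvariantResolvingIdeal ?_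
  intro p hp hA k _ _ _ X f hs hl hq hi
  obtain ⟨L, _, _, _, _, I, Y, ρ, hI0, hρ, hY, hst⟩ :=
    stub_fixedVertexPrinciple p hp hA k X f hs hl hq hi
  haveI := hl
  haveI hXN : IsLocallyNoetherian X := LocallyOfFiniteType.isLocallyNoetherian f
  haveI : IsLocallyNoetherian (Over.mk f : SchemeOver k).left := hXN
  haveI : IsReduced (Over.mk f : SchemeOver k).left := (inferInstance : IsReduced X)
  haveI : GeometricallyReduced (bcSpec k L) := geometricallyReduced_bcSpec_of_isSeparable k L
  haveI : IsReduced (GaloisDescent.bc L (Over.mk f)) := inferInstance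
  obtain ⟨J, hJ0, hJ, hρJ⟩ :=
    stub_invariantIdeal_of_stableRegularBlowup L (Over.mk f) hI0 hρ hst
  exact ⟨L, _, _, inferInstance, inferInstance, J, Y, ρ, hJ0, hJ, hρJ, hY⟩

/-- The composition under the name the skeleton registry expects. [cite: Kollar2007, Thm. 3.36] -/
theorem DescentAlgclosedToPerfect_proof :
    Summit.ResolutionOfSingularities.ResolutionOfSingularities.Theses.Descent.DescentAlgclosedToPerfect :=
  DescentAlgclosedToPerfect_of

/-- The same composition concluding the lead's route copy (`rfl`-equal to the Descent copy).
[cite: Kollar2007, Thm. 3.36] -/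
theorem DescentAlgclosedToPerfect_of_abhyankarShadows :
    Summit.ResolutionOfSingularities.ResolutionOfSingularities.Theses.AbhyankarShadows.DescentAlgclosedToPerfect :=
  DescentAlgclosedToPerfect_of

end Summit.ResolutionOfSingularities.ResolutionOfSingularities.Cruxes.DescentAlgclosedToPerfect.Lines.NpcFixedVertex

end
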